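import Mathlib.Tactic.Linarith
import Mathlib.Tactic.Ring
import Mathlib.Tactic.NormNum
import Mathlib.Data.ZMod.Basic
import Mathlib.Data.Finset.Basic
import Mathlib.Algebra.Order.BigOperators.Group.Finset
import Mathlib.Analysis.Fourier.FiniteAbelian.PontryaginDuality
import HarnessLib

/-!
# The Euler-form barrier, part 3: the ι-window is void for `ℚ(√-7)` on free quotients (determinant square + Lefschetz parity)

Family `hodge`, layer `Literature/AlgebraicGeometry/HodgeTheory`. Companion to `SemiregularityEulerFormBarrier.lean` and
`SemiregularityEulerFormSieve.lean` (section `IotaWindowObjects`); same dictionary (`v = ch(F)` in the basis `Θ^j/j!` on a ppav fourfold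
`X` with Hodge ring `ℚ[θ]`, Euler form `Q(v) = 2v₀v₄ − 8v₁v₃ + 6v₂²`, `G₀ ⊂ X` finite, `π : X → Y = X/G₀`, `ι = −1_Y`, `F̄` simple
`ι`-equivariant on `Y` with `ch(π^*F̄) = v`). Ladder note `papers/HodgeConjecture/hodge-weil-ladder`, section "The ι-window at the object
level" (generation 11), `IOTA-WINDOW.md` §§1–2. Def-free, fully proved elementary statements; the geometry is in the docstrings.

RECAP (part 2). `ι`-semiregularity of `F̄` ⟺ the design equation `χ(F̄,F̄) + χ_ι + 4e₁^ι = 28` together with `ker ob = ann(ch)`; quotient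
integrality (`ch(F̄) ∈ H^{ev}(Y,ℤ)`) leaves, for `K = ℚ(√-7)` and `|G₀| ≤ 63`, only rows with `v ∈ 2ℤ⁵` and `χ(F̄,F̄) = 28`, where
`χ_ι = (1/16)Σ_{p∈Y[2]} t_p² = 0`, i.e. ALL local indices `t_p = Σ_i (−1)^i tr(ι | Tor_i(F̄,k(p)))` vanish (`chibar_twentyEight_rigid`).

TWO CONSEQUENCES OF `t_p = 0 ∀p` (NEW here).
(D) DETERMINANT SQUARE. `ι` acts on `det(F̄)_p = det(F̄ ⊗^L k(p))` by `(−1)^{n⁻_p}`, `n⁻_p = (rk − t_p)/2 = rk/2` — the SAME sign at all 256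
points; the induced linearisation of the symmetric line bundle `det F̄` is `±` Mumford's normalised one, so `e_*^{det F̄}` is constant (`= 1`) on
`Y[2]`; by [LangeBirkenhake1992, Lemma 2.3.10 and Exercise 2.3.7 (1)] (`e_*^L = q_L`, `q_{L(H,χ)}(v̄) = χ(2v)`, a quadratic form with
polar form `e^H(v̄,w̄) = (−1)^{Im H(λ,μ)}`; Mumford's `e_*^L`), `e_*^{det F̄} ≡ 1` means `χ ≡ 1` on `Λ_Y`, whence `Im H` is EVEN on `Λ_Y` and
`det F̄ = L(H,1) = L(H/2,ψ)^{⊗2}` is the square of a symmetric line bundle (Mumford's totally-symmetric criterion); hence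
`c₁(F̄) ∈ 2NS(Y)` and, by quotient integrality in degree 1 applied to the INTEGRAL class `c₁(F̄)/2` on `Y`, **`2L₁ ∣ v₁`** with
`L₁ = lcm(d₁, p^{w₁})` the full degree-1 modulus of [QI] (a)(b)(b′) (`d₁` = exponent of `G₀`; so `2d₁ ∣ v₁` always, sharpened to `8 ∣ v₁`
as soon as `G₀` has 2-rank `≥ 5` — load-bearing in exactly one cell of the range, `|G₀| = 32`, `G₀ = (ℤ/2)⁵`, `N(x) = 64`, `χ̄ = 28`;
ERRATUM E4 to the generation-11 wording '`2d₁ ∣ v₁`', LADDER C87 (c), certified GAPS G71 (c′); the script always used `2L₁`).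
(L0) LEFSCHETZ PARITY. The holomorphic Lefschetz number `L(ι, F̄) = Σ(−1)^i tr(ι|H^i(Y,F̄)) = Σ_p t_p/16 = 0` [AtiyahBott1968, §4]; as
`χ ≡ L(ι,·) (mod 2)`, `χ(Y,F̄)` is EVEN: **`2|G₀| ∣ v₄`**.
With (D) and (L0) every surviving row dies; the two smallest are kernel certificates below (invariant residue sets under the orbit
generators `T = ⊗𝒪(Θ)`, `Φ`, `[1]`, `∨`), the rest is the exact script `iota_integrality.py F` (all abelian `G₀` with `|G₀| ≤ 63`, all
`ℚ(√-7)`-secant classes with `Q ≤ 28|G₀|`: VOID; first numerically open row at `|G₀| = 64`, `G₀ = ℤ/4 × (ℤ/2)⁴`, `Q = 896`, where only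
necessary conditions were tested).

**THEOREM (ι-window void for the hub's field).** Let `X` be a ppav fourfold with Hodge ring `ℚ[θ]`, `G₀ ⊂ X` a finite subgroup with
`|G₀| ≤ 63` (or `|G₀| = 1`), `Y = X/G₀`, and `F̄ ∈ D^b(Y)` simple, `(−1)`-equivariant, with `ℚ(√-7)`-secant class `ch(π^*F̄)`. Then `F̄` is not
`ι`-semiregular; equivalently the `ι`-equivariant Lemma 8.3.4 of [Markman2025SecantWeil] has no instance on `Y`. (Pen-and-paper inputs, audited
in-cell: Lefschetz–Riemann–Roch at isolated fixed points; K-theory of tori; the Weil form `e_*^L = q_L`; transpose duality `σ = obᵀ`.)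

PART 4 (generation 12, section `H2FourZeroVoid`; ladder note `H2-CENSUS.md`). TWISTED LEFSCHETZ PARITY (L⁺): for every `ε ∈ Ŷ[2]`
(normalised linearisation of `P_ε` acts at `p ∈ Y[2]` by the character `ε(p)`), the `ι`-equivariant object `F̄ ⊗ P_ε` has local indices
`ε(p)t_p` and `χ(Y, F̄ ⊗ P_ε) = χ(Y, F̄)`, so (L0)-parity for it reads **`Σ_p ε(p) t_p ≡ 16·χ(Y,F̄) (mod 32)`** for all 256 characters `ε`
(`twistedLefschetzParity`). Equivalently: the local indices of the Fourier–Mukai transform, `t_ε(Φ F̄) = (1/16)Σ_p ε(p)t_p`, have the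
parity of `rk Φ F̄ = χ(F̄)`. CONSEQUENCES. (Λ₈) If `rk F̄` is even and `χ_ι(F̄) = Σ t_p²/16 ≤ 15` then (D⁺) gives `t = 4s` and (L⁺) gives
`χ(Y,F̄)` even and `ŝ(ε) := Σ_p ε(p)s_p ∈ 8ℤ` for every `ε`; since `|ŝ(ε)| ≤ Σ|s_p| ≤ Σ s_p² = χ_ι`, **`χ_ι ≤ 7 ⟹ t ≡ 0`**
(`charSum_mul_abs_le_sum_sq`, `charSum_eq_zero_of_dvd_eight`, Fourier inversion `eq_zero_of_forall_charSum_eq_zero`); with the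
Reed–Muller structure of `{s : ŝ ∈ 8ℤ^{256}}` (odd coordinates form a word of `RM(5,8)`), `χ_ι ≤ 15 ⟹ χ_ι ∈ {0, 8, 12, 14}`.
**THEOREM (H2, sub-case (4,0) void for every object).** `X` a ppav fourfold, `F ∈ D^b(X)` `ι`-equivariant perfect of even rank with
`χ(X,F)` even (e.g. `ch(F) ∈ 2ℤ⁵` — every class of the `ℚ(√-3)` habitat H2, `χ(F,F) = 24`): then `χ_ι(F) ∉ {1,…,7}`; in particular the
design pair `(χ_ι, e₁^ι) = (4,0)` of H2 is EMPTY for every object (sheaf or complex, any support), and H2 reduces to the single pair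
`(0,1)`: all 256 local indices vanish, `det F ≅ 𝒪(Θ)^{⊗v₁}` totally symmetric, `dim Ext¹(F,F)^ι = 1`, `dim Ext²(F,F)^ι = 12 = rank ob_F`.
Kernel below: the parity core, the inequality `4|Σ ε t| ≤ Σ t²` for `t ∈ 4ℤ`, the two divisibility kills, and Fourier inversion on a
finite abelian group (Mathlib `AddChar.sum_apply_eq_ite`). Pen-and-paper (certified G71 (e) / GP11-8): (D⁺)(i) `t ∈ 4ℤ`, T-ι, (L0).
-/

namespace Literature.AlgebraicGeometry.HodgeTheory

section IotaWindowVoid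

/-- **(D) arithmetic core.** If `n⁺ + n⁻ = rk` and `n⁺ − n⁻ = t` with `t = 0` (balanced local index), then `rk` is even and `n⁻ = rk/2`:
the sign `(−1)^{n⁻}` of `ι` on `det(F̄)_p` is the same at every fixed point. [folklore] -/
theorem detSign_exponent_constant (np nm rk t : ℤ) (h1 : np + nm = rk) (h2 : np - nm = t) (ht : t = 0) :
    2 ∣ rk ∧ 2 * nm = rk := by
  subst ht
  constructor
  · exact ⟨nm, by omega⟩
  · omega

/-- **(L0) arithmetic core.** With `h^i_±` the dimensions of the `ι`-eigenspaces of `H^i(Y,F̄)` (`i = 0..4`), the Euler characteristic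
`χ = Σ(−1)^i(h^i_+ + h^i_−)` and the Lefschetz number `L = Σ(−1)^i(h^i_+ − h^i_−)` have the same parity; so `L = 0` (all `t_p = 0`,
[AtiyahBott1968 §4]) forces `χ(Y,F̄)` even, i.e. `2|G₀| ∣ v₄ = |G₀|·χ(Y,F̄)`. [cite: AtiyahBott1968, §4 (holomorphic Lefschetz formula)] -/
theorem lefschetzParity (a0 b0 a1 b1 a2 b2 a3 b3 a4 b4 χ L n v4 : ℤ)
    (hχ : χ = (a0 + b0) - (a1 + b1) + (a2 + b2) - (a3 + b3) + (a4 + b4))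
    (hL : L = (a0 - b0) - (a1 - b1) + (a2 - b2) - (a3 - b3) + (a4 - b4)) (hL0 : L = 0) (hv : v4 = n * χ) :
    2 ∣ χ ∧ 2 * n ∣ v4 := by
  have h2 : 2 ∣ χ := ⟨a0 - a1 + a2 - a3 + a4, by omega⟩
  refine ⟨h2, ?_⟩
  obtain ⟨c, hc⟩ := h2
  exact ⟨c, by rw [hv, hc]; ring⟩

/-- **Row `(Q = 56, v = 2w, |G₀| = 2)`: invariant residue set.** The residues mod `2` of the minimal `ℚ(√-7)` orbit (orbit of
`v(1) = (0,1,−7,35,−147)` under `T = ⊗𝒪(Θ)`: `v ↦ e^Θ v`, `Φ : v ↦ (v₄,−v₃,v₂,−v₁,v₀)`, `[1]`, `∨`) form the 3-element set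
`S = {(0,1,1,1,1), (1,1,1,1,0), (1,0,0,0,1)}`: it contains `v(1) mod 2` and is stable under the generators (mod `2`, `[1]` and `∨` act
trivially). [folklore] -/
theorem minimalOrbit_mod_two_certificate :
    ∀ S : Finset (ZMod 2 × ZMod 2 × ZMod 2 × ZMod 2 × ZMod 2), S = {(0,1,1,1,1), (1,1,1,1,0), (1,0,0,0,1)} →
    ((0 : ZMod 2), (1 : ZMod 2), (-7 : ZMod 2), (35 : ZMod 2), (-147 : ZMod 2)) ∈ S ∧
    (∀ v ∈ S, (v.1, v.1 + v.2.1, v.1 + 2 * v.2.1 + v.2.2.1, v.1 + 3 * v.2.1 + 3 * v.2.2.1 + v.2.2.2.1,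
        v.1 + 4 * v.2.1 + 6 * v.2.2.1 + 4 * v.2.2.2.1 + v.2.2.2.2) ∈ S) ∧
    (∀ v ∈ S, (v.2.2.2.2, -v.2.2.2.1, v.2.2.1, -v.2.1, v.1) ∈ S) ∧
    (∀ v ∈ S, (-v.1, -v.2.1, -v.2.2.1, -v.2.2.2.1, -v.2.2.2.2) ∈ S) ∧
    (∀ v ∈ S, (v.1, -v.2.1, v.2.2.1, -v.2.2.2.1, v.2.2.2.2) ∈ S) ∧
    (∀ v ∈ S, ¬ (v.2.1 = 0 ∧ v.2.2.2.2 = 0)) := by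
  rintro S rfl
  refine ⟨?_, ?_, ?_, ?_, ?_, ?_⟩ <;> decide

/-- **Row `(Q = 56, v = 2w, |G₀| = 2)` is void.** For the class `v = 2w` of an object on `Y = X/(ℤ/2)` with `w` in the minimal orbit:
(D) needs `4 ∣ v₁ = 2w₁` and (L0) needs `4 ∣ v₄ = 2w₄`, i.e. `w₁`, `w₄` both even — excluded by the certificate (no residue in `S` has
`w₁ ≡ w₄ ≡ 0`). Arithmetic form: `w₁ % 2 = 1 ∨ w₄ % 2 = 1` is incompatible with `4 ∣ 2w₁ ∧ 4 ∣ 2w₄`. [folklore] -/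
theorem doubledMinimal_orderTwo_void (w₁ w₄ : ℤ) (hS : w₁ % 2 = 1 ∨ w₄ % 2 = 1) :
    ¬ (4 ∣ 2 * w₁ ∧ 4 ∣ 2 * w₄) := by
  rintro ⟨⟨a, ha⟩, ⟨b, hb⟩⟩
  omega

set_option maxRecDepth 16384 in
/-- **Row `(Q = 112, v = 2w′, |G₀| = 4)`: invariant residue set mod `4`.** `w′` runs over the `ℚ(√-7)` orbit of norm `2`
(`v(4+θ) = (1,−3,7,−7,−49)`; the four elements of norm `2` give the same residue set); its residues mod `4` form the 24-element set `S₄`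
below, containing `w′ mod 4` and stable under `T`, `Φ`, `[1]`, `∨`; NO element has `w′₁, w′₂, w′₃` even and `w′₄ ≡ 0 (mod 4)` — which is what
integrality for `(ℤ/2)²` (`2 ∣ v₁`, `4 ∣ v₂, v₃, v₄`) plus (D) (`4 ∣ v₁`) plus (L0) (`8 ∣ v₄`) demand of `v = 2w′`; `ℤ/4` demands more.
[folklore] -/
theorem normTwoOrbit_mod_four_certificate :
    ∀ S₄ : Finset (ZMod 4 × ZMod 4 × ZMod 4 × ZMod 4 × ZMod 4), S₄ =
      {(1,0,0,0,2), (1,0,2,2,2), (1,1,1,1,3), (1,1,3,1,3), (1,2,0,0,2), (1,2,2,2,2), (1,3,1,3,3), (1,3,3,3,3),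
       (2,0,0,0,1), (2,0,0,0,3), (2,0,0,2,1), (2,0,0,2,3), (2,2,2,0,1), (2,2,2,0,3), (2,2,2,2,1), (2,2,2,2,3),
       (3,0,0,0,2), (3,0,2,2,2), (3,1,1,1,1), (3,1,3,1,1), (3,2,0,0,2), (3,2,2,2,2), (3,3,1,3,1), (3,3,3,3,1)} →
    ((1 : ZMod 4), (-3 : ZMod 4), (7 : ZMod 4), (-7 : ZMod 4), (-49 : ZMod 4)) ∈ S₄ ∧
    (∀ v ∈ S₄, (v.1, v.1 + v.2.1, v.1 + 2 * v.2.1 + v.2.2.1, v.1 + 3 * v.2.1 + 3 * v.2.2.1 + v.2.2.2.1,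
        v.1 + 4 * v.2.1 + 6 * v.2.2.1 + 4 * v.2.2.2.1 + v.2.2.2.2) ∈ S₄) ∧
    (∀ v ∈ S₄, (v.2.2.2.2, -v.2.2.2.1, v.2.2.1, -v.2.1, v.1) ∈ S₄) ∧
    (∀ v ∈ S₄, (-v.1, -v.2.1, -v.2.2.1, -v.2.2.2.1, -v.2.2.2.2) ∈ S₄) ∧
    (∀ v ∈ S₄, (v.1, -v.2.1, v.2.2.1, -v.2.2.2.1, v.2.2.2.2) ∈ S₄) ∧
    (∀ v ∈ S₄, ¬ ((v.2.1 = 0 ∨ v.2.1 = 2) ∧ (v.2.2.1 = 0 ∨ v.2.2.1 = 2) ∧ (v.2.2.2.1 = 0 ∨ v.2.2.2.1 = 2) ∧ v.2.2.2.2 = 0)) := by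
  rintro S₄ rfl
  refine ⟨?_, ?_, ?_, ?_, ?_, ?_⟩ <;> decide

/-- **Why `χ(F̄,F̄) = 28` is the only integrality survivor up to `|G₀| ≤ 63` and why it dies.** Summary arithmetic: in a row with
`v ∈ 2ℤ⁵`, `|G₀| = N(x)/2`, the design equation leaves `χ_ι = e₁^ι = 0` (`chibar_twentyEight_rigid`); then (D) `2L₁ ∣ v₁`
(`L₁ = lcm(d₁, 2^{w₁})`: `2d₁ ∣ v₁`, sharpened to `8 ∣ v₁` at 2-rank `≥ 5` — ERRATUM E4) and (L0)
`2|G₀| ∣ v₄` must hold for the SAME residue vector that passes quotient integrality — and the script (exact BFS of orbit residues,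
`iota_integrality.py F`) finds none for any abelian `G₀` with `2 ≤ |G₀| ≤ 63`; at `|G₀| = 1` the window is void by parity (`χ ≥ 14 > 12`
for odd type, `χ ≥ 56 > 28` for even type). This lemma records the `|G₀| = 1` arithmetic. [folklore] -/
theorem sqrtMinus7_trivialQuotient_void (χ χι e : ℤ) (he : 0 ≤ e) (hχι : 0 ≤ χι)
    (h : (14 ≤ χ ∧ 16 ≤ χι) ∨ 56 ≤ χ) : χ + χι + 4 * e ≠ 28 := by
  omega

end IotaWindowVoid

section H2FourZeroVoid

/-- **(L⁺) twisted Lefschetz parity — arithmetic core.** For an `ι`-equivariant object `G` on `Y` write `P = Σ(−1)^i h^i_+`,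
`M = Σ(−1)^i h^i_−`; then `χ(Y,G) = P + M` and the Lefschetz number is `L(ι,G) = P − M`, so `χ + L = 2P` and `16·L ≡ 16·χ (mod 32)`.
Applied to `G = F̄ ⊗ P_ε` (`ε ∈ Ŷ[2]`, normalised linearisation acting at `p ∈ Y[2]` by the character `ε(p)`; `χ(F̄ ⊗ P_ε) = χ(F̄)`;
holomorphic Lefschetz `16·L(ι, F̄ ⊗ P_ε) = Σ_p ε(p)t_p` [AtiyahBott1968 §4]): `T_ε := Σ_p ε(p) t_p ≡ 16χ(Y,F̄) (mod 32)`; in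
particular `32 ∣ T_ε` for every character as soon as `χ(Y,F̄)` is even (e.g. `ch(π^*F̄) ∈ 2ℤ⁵`, `|G₀| = 1`).
[cite: AtiyahBott1968, §4 (holomorphic Lefschetz formula); LangeBirkenhake1992, Lemma 2.3.10 / Exercise 2.3.7 (1) (`e_*^{P_ε} = ε`)] -/
theorem twistedLefschetzParity (χ L P M T : ℤ) (hχ : χ = P + M) (hL : L = P - M) (hT : T = 16 * L)
    (heven : 2 ∣ χ) : 32 ∣ T := by
  obtain ⟨c, hc⟩ := heven
  exact ⟨c - M, by omega⟩

/-- Termwise bound: if `t = 0` or `|t| ≥ c` then `c·|t| ≤ t²` (used with `c = 4` for local indices `t_p ∈ 4ℤ`, and with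
`c = 1` for `s_p ∈ ℤ`). [folklore] -/
theorem mul_abs_le_sq (c t : ℤ) (h : t = 0 ∨ c ≤ |t|) : c * |t| ≤ t ^ 2 := by
  rcases h with rfl | h
  · simp
  · have habs : (0 : ℤ) ≤ |t| := abs_nonneg t
    calc c * |t| ≤ |t| * |t| := by exact mul_le_mul_of_nonneg_right h habs
      _ = t ^ 2 := by rw [← sq, sq_abs]

/-- **Character sums are short.** For `ε_p = ±1` and local indices with `t_p = 0 ∨ c ≤ |t_p|` (`c ≥ 0`):
`c·|Σ_p ε_p t_p| ≤ Σ_p t_p² (= 16χ_ι)`. With `c = 4` (all `t_p ∈ 4ℤ`, (D⁺)(i)) and `Σ t_p² = 64` (the H2 pair `(4,0)`):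
`|T_ε| ≤ 16`. [folklore] -/
theorem charSum_mul_abs_le_sum_sq {m : ℕ} (c : ℤ) (hc : 0 ≤ c) (t ε : Fin m → ℤ)
    (hε : ∀ i, ε i = 1 ∨ ε i = -1) (ht : ∀ i, t i = 0 ∨ c ≤ |t i|) :
    c * |∑ i, ε i * t i| ≤ ∑ i, (t i) ^ 2 := by
  calc c * |∑ i, ε i * t i| ≤ c * ∑ i, |ε i * t i| := by
        exact mul_le_mul_of_nonneg_left (Finset.abs_sum_le_sum_abs _ _) hc
    _ = ∑ i, c * |t i| := by
        rw [Finset.mul_sum]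
        refine Finset.sum_congr rfl (fun i _ => ?_)
        rcases hε i with h | h <;> simp [h]
    _ ≤ ∑ i, (t i) ^ 2 := Finset.sum_le_sum (fun i _ => mul_abs_le_sq c (t i) (ht i))

/-- **The (4,0) kill.** A character sum `T` with `32 ∣ T` (twisted Lefschetz parity, `χ(F̄)` even) and `4|T| ≤ 64`
(`t ∈ 4ℤ`, `Σ t² = 64`) vanishes. Hence in H2's pair `(χ_ι, e₁^ι) = (4,0)` ALL 256 character sums of `t` vanish, so `t ≡ 0` by
Fourier inversion (`eq_zero_of_forall_charSum_eq_zero`) — contradicting `Σ t_p² = 64`: **(4,0) is void for every object.** [folklore] -/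
theorem charSum_eq_zero_of_dvd_thirtyTwo (T : ℤ) (h32 : 32 ∣ T) (hle : 4 * |T| ≤ 64) : T = 0 := by
  obtain ⟨c, rfl⟩ := h32
  rcases abs_cases (32 * c) with ⟨h, _⟩ | ⟨h, _⟩ <;> omega

/-- **The Λ₈ kill (`χ_ι ≤ 7 ⟹ t ≡ 0`).** With `t = 4s` ((D⁺)(i), `χ_ι ≤ 15`, even rank) the parity `4ŝ(ε) ≡ 16χ(F̄) (mod 32)` forces
`χ(F̄)` even (else `|ŝ(ε)| ≥ 4` for all 256 `ε` and Parseval gives `χ_ι ≥ 16`) and then `8 ∣ ŝ(ε)`; a character sum with `8 ∣ S` and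
`|S| ≤ Σ s_p² = χ_ι ≤ 7` vanishes. So `χ_ι ∈ {1,…,7}` never occurs for even-rank `ι`-equivariant objects on `Y`; the order-64 boundary
pairs `(6,2)`, `(2,3)` of THEOREM Q7-VOID's first open cell die here as well. [folklore] -/
theorem charSum_eq_zero_of_dvd_eight (S : ℤ) (h8 : 8 ∣ S) (hle : 1 * |S| ≤ 7) : S = 0 := by
  obtain ⟨c, rfl⟩ := h8
  rcases abs_cases (8 * c) with ⟨h, _⟩ | ⟨h, _⟩ <;> omega

/-- **Fourier inversion on a finite abelian group (the step `all character sums vanish ⟹ t ≡ 0`).** For `t : G → ℂ` on a finite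
abelian group `G` (here `G = Y[2] ≅ (ℤ/2)⁸`, characters `= Ŷ[2]` via the Weil pairing): if `Σ_p ψ(p) t(p) = 0` for every character
`ψ`, then `t = 0`. Proof: `Σ_ψ ψ(−q)·Σ_p ψ(p)t(p) = Σ_p t(p) Σ_ψ ψ(p − q) = |G|·t(q)` by `AddChar.sum_apply_eq_ite`. [folklore] -/
theorem eq_zero_of_forall_charSum_eq_zero {G : Type*} [AddCommGroup G] [Fintype G] [DecidableEq G]
    (t : G → ℂ) (h : ∀ ψ : AddChar G ℂ, ∑ p, ψ p * t p = 0) : t = 0 := by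
  funext q
  have key : ∑ ψ : AddChar G ℂ, ψ (-q) * ∑ p, ψ p * t p = (Fintype.card G : ℂ) * t q := by
    calc ∑ ψ : AddChar G ℂ, ψ (-q) * ∑ p, ψ p * t p
        = ∑ ψ : AddChar G ℂ, ∑ p, ψ (p + -q) * t p := by
          refine Finset.sum_congr rfl (fun ψ _ => ?_)
          rw [Finset.mul_sum]
          refine Finset.sum_congr rfl (fun p _ => ?_)
          rw [AddChar.map_add_eq_mul]; ring
      _ = ∑ p, (∑ ψ : AddChar G ℂ, ψ (p + -q)) * t p := by
          rw [Finset.sum_comm]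
          refine Finset.sum_congr rfl (fun p _ => ?_)
          rw [Finset.sum_mul]
      _ = ∑ p, (if p + -q = 0 then (Fintype.card G : ℂ) else 0) * t p := by
          refine Finset.sum_congr rfl (fun p _ => ?_)
          rw [AddChar.sum_apply_eq_ite]
      _ = (Fintype.card G : ℂ) * t q := by
          have hiff : ∀ p : G, (p + -q = 0) ↔ (p = q) := fun p => by
            constructor <;> intro hp
            · exact (neg_add_eq_zero.mp (by rwa [add_comm] at hp)).symm
            · subst hp; exact add_neg_cancel p
          simp_rw [hiff, ite_mul, zero_mul]
          rw [Finset.sum_ite_eq' Finset.univ q]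
          simp
  have hzero : ∑ ψ : AddChar G ℂ, ψ (-q) * ∑ p, ψ p * t p = 0 := by
    refine Finset.sum_eq_zero (fun ψ _ => ?_)
    rw [h ψ, mul_zero]
  rw [hzero] at key
  have hcard : (Fintype.card G : ℂ) ≠ 0 := Nat.cast_ne_zero.mpr Fintype.card_ne_zero
  exact (mul_eq_zero.mp key.symm).resolve_left hcard

end H2FourZeroVoid

section H2ZeroOneSieve

/-!
### Part 5 (generation 13): sieves for H2's residual pair `(0,1)` — the `2^c` local-index rule and the TWO-SECTION LEMMA

Ladder note `H2-ZERO-ONE.md` (generation 13). Standing data of the pair `(0,1)` (Part 4): `X` a ppav fourfold, `ι = −1_X`, `F` simple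
`ι`-equivariant with `ch(F) = 2w` (`w` in the principal `ℚ(√-3)` orbit, `χ(F,F) = 24`), all 256 local indices `t_p = 0`,
`dim Ext¹(F,F)^ι = 1`, `Ext²(F,F)^ι = ob(HT²(X))`. Two def-free arithmetic cores are recorded here.

(T4) THE `2^c` RULE (carver C102, re-derived). If `S ∋ p` is `ι`-stable and smooth of codimension `c` at the 2-torsion point `p`, with
`ι`-anti-invariant local equations `x₁,…,x_c` completed to a regular system of parameters, then for a coherent `ι`-sheaf `M` on `S`,
`i_*M ⊗^L k(p) ≅ ∧^•(k^c) ⊗_k (M ⊗^L_{𝒪_S} k(p))` with ZERO differentials on the Koszul factor and `ι = (−1)^b` on `∧^b`; the supertrace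
weight of homological degree `b` is `(−1)^b`, so `t_p(i_*M) = (Σ_b C(c,b)·(−1)^b(−1)^b)·st_S(M,p) = 2^c·st_S(M,p)`
(`koszulSupertrace_factor`), and `st_S(M,p) ≡ rk_p M (mod 2)`.

(TS) THE TWO-SECTION LEMMA (new). Shape (a) of the census: `F = ker(φ : E ↠ T)`, `E = F^{∨∨}` flat of rank 2
(`E ∈ {P ⊕ P^{-1}, P⁺ ⊕ P′⁻, P ⊗ U₂}` — forced when `E` is `μ`-semistable with `c₁ = 0 = c₂·θ²`, by Bando–Siu / Simpson), `T` a
torsion-free rank-one `𝒪_S`-module on an integral `ι`-invariant l.c.i. surface `S` of class `θ²` whose reflexive hull `N := T^{**}` is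
invertible. Then `φ|_S : E_S → N` is given by two sections and `T = N ⊗ 𝔞` with `ℓ := ℓ(𝒪_S/𝔞) < ∞`; the kernel
`K = ker(E_S → N𝔞) ≅ det E_S ⊗ N^{-1}` is invertible (Koszul on the CM surface `S`), `F ⊇ E ⊗ 𝓘_S` with `F/(E ⊗ 𝓘_S) = i_*K`, hence
`χ(F(mΘ)) = 2χ(𝓘_S(mΘ)) + χ(S, K(mθ_S))` and `2χ(𝒪_S(m)) = χ(K(m)) + χ(N(m)) − ℓ` for all `m` (Riemann–Roch for Cartier divisors on
the Gorenstein surface `S`). For the COMPLETE INTERSECTIONS `S_a = Θ_a ∩ Θ_{−a}` (`a ∉ X[2]`; `ι`-invariant, class `θ²`,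
`S_a ∩ X[2] = X[2] ∩ (Θ − a)`, empty for general `a`; `ω_S = 𝒪_S(2Θ)`, `χ(𝒪_S(m)) = 12m² − 24m + 14`) and the target
`χ(F(mΘ)) = Σ_j C(4,j)v_j m^{4−j} = 2m⁴ − 12m² + 8m` (`v = (2,0,−2,2,0)`), comparing coefficients gives `N·θ_S = 16`, `N² = −4` and
`ℓ = N² = −4 < 0`: **shape (a) with flat hull is VOID on every symmetric theta-intersection `Θ_a ∩ Θ_{−a}` of every ppav fourfold**
(`twoSection_ci_void`; this includes the 255·… pairs `Θ_κ ∩ Θ_κ′` of C102 without the smoothness hypothesis (h-gen)). In general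
`ch₄(F) = −χ(𝒪_S) + p_a(N) − 1` (`twoSection_chi4`), so `(0,1)` needs `p_a(N) = χ(𝒪_S) + 1` with `N² = ℓ ≥ 0`; on the difference
surface `C − C` of a genus-4 Jacobian the same bookkeeping (with `R¹α_*` of length 4 at the vertex) gives `χ(T) ≤ −3 ≠ 0` — void too
(ladder note §2.3). No statement of [Markman2025SecantWeil] is used.
-/

/-- **(T4) Koszul supertrace factor.** In the decomposition `i_*M ⊗^L k(p) ≅ ⊕_b ∧^b(k^c)[b] ⊗ (M ⊗^L_{𝒪_S} k(p))` at a smooth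
point of codimension `c` of the `ι`-stable support (local equations `ι`-anti-invariant), `ι` acts on `∧^b` by `(−1)^b` and the
homological degree `b` carries the supertrace sign `(−1)^b`; the total factor is `Σ_b C(c,b)(−1)^b(−1)^b = 2^c`. Hence
`t_p(i_*M) = 2^c · st_S(M,p)` (`c = 4`: skyscrapers, `16`; `c = 1`: divisors, `2·tr(ι|M_p)`; `c = 2`: surfaces, `4·st`).
[folklore] -/
theorem koszulSupertrace_factor (c : ℕ) :
    ∑ b ∈ Finset.range (c + 1), (Nat.choose c b : ℤ) * ((-1) ^ b * (-1) ^ b) = 2 ^ c := by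
  have h : ∀ b : ℕ, ((-1 : ℤ) ^ b * (-1) ^ b) = 1 := fun b => by
    rw [← mul_pow]; norm_num
  simp_rw [h, mul_one]
  exact_mod_cast Nat.sum_range_choose c

/-- **(TS) two-section lemma, general form of the Euler characteristic.** With `χS = χ(𝒪_S)`, `N2 = N²`, `NK = N·ω_S`,
`2p_a − 2 = N² + N·ω_S` (adjunction) and `ch₄(F) = χ(X,F) = 2χ(𝓘_S) + χ(S,K)`, `χ(𝓘_S) = −χ(𝒪_S)`,
`χ(S,K) = χ(𝒪_S) + (N² + N·ω_S)/2` (`K ≡ −N`, Riemann–Roch on `S`): `ch₄(F) = −χ(𝒪_S) + p_a(N) − 1`. For the pair `(0,1)`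
(`ch₄(F) = v₄ = 0`) this is the constraint `p_a(N) = χ(𝒪_S) + 1`, to be met with `N² = ℓ(W) ≥ 0`. [folklore] -/
theorem twoSection_chi4 (χS N2 NK pa ch4 : ℤ) (hpa : 2 * pa - 2 = N2 + NK)
    (hch4 : 2 * ch4 = 2 * (-2 * χS) + (2 * χS + N2 + NK)) : ch4 = -χS + pa - 1 := by
  omega

/-- **(TS) two-section lemma on the theta-intersections `S_a = Θ_a ∩ Θ_{−a}`: VOID.** Unknowns: `N2 = N²`, `Nθ = N·θ_S`,
`ℓ = ℓ(𝒪_S/𝔞)`. Hypothesis `hpoly`: `2χ(F(mΘ))` computed as `2·[2χ(𝓘_S(m))] + 2χ(S,K(m))` with `χ(𝓘_S(m)) = m⁴ − χ(𝒪_S(m))`,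
`χ(𝒪_S(m)) = 14 + 12m² − 24m`, `2χ(S,K(m)) = 28 + N² + 2N·θ_S(1 − m) + 24m² − 48m` (`K ≡ −N`, `ω_S ≡ 2θ_S`, `θ_S² = 24`), equated
with the target `2(2m⁴ − 12m² + 8m)` of `v = (2,0,−2,2,0)`. Hypothesis `hW`: `χ(K(m)) + χ(N(m)) − ℓ = 2χ(𝒪_S(m))` from
`0 → K → E_S → N ⊗ 𝔞 → 0` (`c(E_S) = 1`). Conclusion: `m = 0, 1` give `N·θ_S = 16`, `N² = −4 = ℓ`, contradicting `ℓ ≥ 0`.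
So no `(0,1)` object of shape (a) with flat reflexive hull is carried by any `Θ_a ∩ Θ_{−a}` (any `a ∉ X[2]`, any ppav fourfold).
[folklore] -/
theorem twoSection_ci_void (N2 Nθ ℓ : ℤ)
    (hpoly : ∀ m : ℤ, 2 * (2 * m ^ 4 - 12 * m ^ 2 + 8 * m)
      = 2 * (2 * (m ^ 4 - (14 + 12 * m ^ 2 - 24 * m))) + (28 + N2 + 2 * Nθ * (1 - m) + 24 * m ^ 2 - 48 * m))
    (hW : ∀ m : ℤ, (28 + N2 + 24 * m ^ 2 - 48 * m) - ℓ = 2 * (14 + 12 * m ^ 2 - 24 * m))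
    (hℓ : 0 ≤ ℓ) : False := by
  have h0 := hpoly 0
  have h1 := hpoly 1
  have w0 := hW 0
  norm_num at h0 h1 w0
  omega

end H2ZeroOneSieve

section H2ZeroOneTorsion

/-!
### Part 6 (generation 14): the arithmetic skeleton of `H2-ZERO-ONE-2` — the `C × C` class sieve, the `ι`-pairing length bound,
### the two-section count WITH 0-dimensional torsion (erratum E7), and the base-point budget

Ladder note `H2-ZERO-ONE-2.md` (generation 14). The local content of that note (the syzygy-lifting criterion for first-order
Poisson liftability, the WHISKER and BASE-POINT lemmas, the colength-`≤ 2` classification) is module theory over `k[[x₁..x₄]]`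
certified by an exact script; the tree has no carriers for it (DIVERGENCE D5). Recorded here are the four integer steps that the
note's global statements run on.

(1) `C × C` CLASS SIEVE (note §3.2). On `P = C × C` (`C` general of genus 4, `NS(P) = ℤf₁ ⊕ ℤf₂ ⊕ ℤδ`, `f₁f₂ = f_iδ = 1`, `δ² = −6`,
`φ_*f_i = γ = θ³/6`, `φ_*δ = 0` under the difference map `φ : P → J(C)`) an irreducible curve `D ≡ af₁ + bf₂ + cδ` which is neither
the diagonal nor a fibre satisfies `D·f₁ = b + c ≥ 1`, `D·f₂ = a + c ≥ 1`, `D·Δ = a + b − 6c ≥ 0`; if `φ_*[D] = (a+b)γ` has class `≤ 4γ`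
then either `c = 0` (valence zero — excluded geometrically: the induced endomorphism of `J(C)` vanishes, so `x ↦ D(x)` maps `C` to a
`g^r_b`, `b ≤ 3`, forcing a degree-`≤ 1` map `C → ℙ¹`) or `(a,b,c) = (2,2,−1)` (the graph of a hyperelliptic involution — absent).
Hence the curves of class `≤ 4γ` inside `S = C − C` are unions of the crosses `(C − c) ∪ (c − C)` (`cxc_class_sieve`).

(2) `ι`-PAIRING LENGTH BOUND (note §3.3, §4.2, §5.3). If the curve part of `E/F` has total class `nγ` with `n ≤ 4` and a component
`B` of class `mγ` has generic length `l`, then `l ≤ 2`: either `B ≠ ιB` (the pair contributes `2lm ≤ n`, `m ≥ 1`) or `B = ιB` and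
then `m ≥ 2` (an `ι`-stable curve of minimal class forces a hyperelliptic Jacobian, by Matsusaka–Ran), `lm ≤ n`
(`genericLength_le_two_of_pair`, `genericLength_le_two_of_stable`). Generic length `≤ 2` is exactly the range in which every local
model is Poisson-obstructed (WHISKER lemma and Proposition L2 of the note).

(3) ERRATUM E7: THE TWO-SECTION COUNT WITH TORSION (note §4.1). In Part 5's `twoSection_ci_void` the sheaf `T` was pure. If `T`
has a 0-dimensional torsion subsheaf of length `t` and pure quotient `G = N ⊗ 𝔞`, the same bookkeeping applied to
`F′ = ker(E → G) ⊇ F` (`χ(F′(m)) = χ(F(m)) + t`) gives, on the theta-intersections, `N·θ_S = 16` and `N² = ℓ = 2t − 4` — consistent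
for `t ≥ 2` (`twoSection_ci_torsion`; `t = 0` recovers Part 5's contradiction).

(4) BASE-POINT BUDGET (note §2.3, §4.2). By the BASE-POINT lemma every simple common zero of the two sections must carry torsion of
length `≥ 3`, and by the family argument all torsion sits at base points; with `ℓ` simple base points and total torsion `t`,
`3ℓ ≤ t = ℓ/2 + 2` is impossible for `ℓ ≥ 1`, and `ℓ = 0` forces `t = 2` with nowhere to put the torsion
(`basePoint_budget_void`). No statement of [Markman2025SecantWeil] is used.
-/

/-- **(1) The `C × C` class sieve.** For an irreducible curve `D ≡ a f₁ + b f₂ + c δ` on `C × C` that is neither the diagonal nor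
a fibre (`D·f₁ = b + c ≥ 1`, `D·f₂ = a + c ≥ 1`, `D·Δ = a + b − 6c ≥ 0`) with `φ_*[D]` of class `≤ 4γ` (`a + b ≤ 4`): either the
valence `−c` is zero, or `(a,b,c) = (2,2,−1)`. [folklore] -/
theorem cxc_class_sieve (a b c : ℤ) (hab : a + b ≤ 4) (hΔ : 6 * c ≤ a + b) (h1 : 1 ≤ b + c) (h2 : 1 ≤ a + c) :
    c = 0 ∨ (a = 2 ∧ b = 2 ∧ c = -1) := by
  omega

/-- **(2a) `ι`-pairing length bound, paired components.** A component `B ≠ ιB` of class `mγ` (`m ≥ 1`) and generic length `l`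
contributes `2lm` to the total class `n ≤ 4` of the curve part; hence `l ≤ 2`. [folklore] -/
theorem genericLength_le_two_of_pair (n l m : ℕ) (hn : n ≤ 4) (hm : 1 ≤ m) (h : 2 * l * m ≤ n) : l ≤ 2 := by
  have h1 : 2 * l ≤ 2 * l * m := Nat.le_mul_of_pos_right _ hm
  omega

/-- **(2b) `ι`-pairing length bound, `ι`-stable components.** An `ι`-stable component has class `mγ` with `m ≥ 2` off hyperelliptic
Jacobians (Matsusaka–Ran) and contributes `lm ≤ n ≤ 4`; hence `l ≤ 2`. [folklore] -/
theorem genericLength_le_two_of_stable (n l m : ℕ) (hn : n ≤ 4) (hm : 2 ≤ m) (h : l * m ≤ n) : l ≤ 2 := by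
  have h1 : l * 2 ≤ l * m := Nat.mul_le_mul_left l hm
  omega

/-- **(3) Erratum E7: the two-section count on `Θ_a ∩ Θ_{−a}` with 0-dimensional torsion of length `t`.** Hypotheses as in
`twoSection_ci_void`, with the target Euler characteristic shifted by `t` (`χ(F′(mΘ)) = χ(F(mΘ)) + t`, `F′/F = T₀`): `hpoly` is
`2χ(F′(m)) = 2·[2χ(𝓘_S(m))] + 2χ(S,K(m))`, `hW` is `χ(K(m)) + χ(N(m)) − ℓ = 2χ(𝒪_S(m))`. Conclusion: `N·θ_S = 16`,
`N² = 2t − 4 = ℓ` — the pure case `t = 0` is contradictory (`ℓ ≥ 0`), every `t ≥ 2` is numerically consistent, and the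
decision passes to the base-point budget (4). [folklore] -/
theorem twoSection_ci_torsion (N2 Nθ ℓ t : ℤ)
    (hpoly : ∀ m : ℤ, 2 * (2 * m ^ 4 - 12 * m ^ 2 + 8 * m) + 2 * t
      = 2 * (2 * (m ^ 4 - (14 + 12 * m ^ 2 - 24 * m))) + (28 + N2 + 2 * Nθ * (1 - m) + 24 * m ^ 2 - 48 * m))
    (hW : ∀ m : ℤ, (28 + N2 + 24 * m ^ 2 - 48 * m) - ℓ = 2 * (14 + 12 * m ^ 2 - 24 * m)) :
    Nθ = 16 ∧ N2 = 2 * t - 4 ∧ ℓ = 2 * t - 4 := by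
  have h0 := hpoly 0
  have h1 := hpoly 1
  have w0 := hW 0
  norm_num at h0 h1 w0
  omega

/-- **(4) The base-point budget.** If the `ℓ = 2t − 4` common zeros of the two sections are all simple, each carries torsion of
length `≥ 3` (BASE-POINT lemma) and all torsion sits there (family argument), so `3ℓ ≤ t`; this is impossible once `ℓ ≥ 1`
(and `ℓ = 0` gives `t = 2` with no admissible support). [folklore] -/
theorem basePoint_budget_void (ℓ t : ℤ) (hℓ : ℓ = 2 * t - 4) (hpos : 1 ≤ ℓ) (hbudget : 3 * ℓ ≤ t) : False := by
  omega

end H2ZeroOneTorsion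

section H2ZeroOneTrace

/-!
## Part 7 (generation 15; ladder note `H2-ZERO-ONE-3.md`): the TRACE LEMMA / TORSION THEOREM, the corrected two-section count on
## singular theta-intersections, the index of the non-Cartier `A₁`-module, and the Beauville exponent

SETTING as in Parts 5–6 (`H2ZeroOneSieve`, `H2ZeroOneTorsion`): `X` a ppav fourfold, `ι = −1`, `F` a would-be `(0,1)` object of shape
(4.5)(a) (`F = ker(E ↠ T)`, `E` a flat rank-2 hull, `T` of rank one on an integral `ι`-invariant surface `S` of class `θ²`), `(LP)` = local
first-order liftability along the star product `A_ε = (𝒪[ε], a ⋆ b = ab + ε·½P(da,db))` of every constant bivector `P` [mod (8.3.3)].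

(T) TRACE LEMMA. A `k[ε]`-FLAT `A_ε`-module `W` of finite length (free of rank `t > 0` over `k[ε]`) forces `P(x) = 0`: the operators
`X_i = (x_i ⋆ ·)` are `k[ε]`-linear with `X_iX_j − X_jX_i = ε·(P^{ij} ⋆ ·)`, and `P^{ij}` acts on `W/εW` as `P^{ij}(x)·1 +` nilpotent; taking
`tr_{k[ε]}` gives `0 = ε·t·P^{ij}(x)` (`trace_commutator_eq`, `natCast_mul_eq_zero_of_commutator`). TORSION THEOREM. If `F ⊂ F′` with
`F′/F = T₀` of finite length `t > 0` and `pd F′ ≤ 1` over the regular local ring `R = 𝒪_{X,x}` (dim 4), then `F` is `(LP)`-dead at `x`: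
`Ext²_R(F,R) = Ext⁴_R(F,R) = 0`, `Ext³_R(F,R) ≅ T₀^*`, base change `Ext^i_{A_ε}(F_ε,R) = Ext^i_R(F,R)` for a flat lift `F_ε`, and the
`Ext(F_ε, ·)`-sequence of `0 → R → A_ε → R → 0` exhibit `W = Ext³_{A_ε}(F_ε, A_ε)` as a flat finite-length right `A_ε`-module of rank `t`.
Consequences: every isolated finite-length defect of a locally free sheaf, and every 0-dimensional torsion decoration at a point of `S` that
is not a base point (there `F′ = ker(E ↠ N)` has `pd 1`), is dead — all lengths, all local types (supersedes (pt), Thm E(α), the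
point tables of generation 14); 50 machine verdicts of `lp_node.py` agree.
(C) CORRECTED TWO-SECTION COUNT. On a theta-intersection `S_a` with rational double points, Riemann–Roch for the rank-one reflexive
sheaves `K ≡ −N` and `N` acquires local corrections `c_K`, `c_N` (sums of `δ_w ∈ {0, −1/4}` at `A₁` points); the `m = 0, 1` comparison of
Part 5 then reads `N·θ_S = 16`, `N² = 2t − 4 − 2c_K`, `ℓ = 2t − 4 − c_K + c_N` (`twoSection_ci_corrected`), and since `δ_w(N) ≤ δ_w(K)`
pointwise (`K_w` is free or the syzygy of `N_w`), `ℓ ≥ 0` forces `t ≥ 2` (`torsion_forced_of_corrections`): 0-dimensional torsion at an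
`ι`-FIXED point is necessary, so theta-intersections without 2-torsion points are VOID even when singular (`A₁`).
(I) INDEX OF THE `A₁`-MODULE. At an `ι`-fixed node `S = V(x₄, x₁x₂ − x₃²)` (all coordinates odd) the non-Cartier reflexive module
`M = (x₁,x₃)𝒪_S` has graded Betti degrees `[1,1], [2,2,2,2], [3,3]` over `k[x₁..x₄]`, so its local index
`t_x(i_*M) = Σ_a (−1)^a Σ_j (−1)^{d_{a,j}} = −8 ≢ 0 (mod 16)` (`a1Module_index`), while `t_x(E) = 0` and all finite-length contributions are
multiples of 16: `N` non-Cartier at a fixed node violates `t ≡ 0` (`index_obstruction_fixedNode`). At a fixed node the torsion length and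
the base colength have the same parity (`fixedNode_parity`).
(B) BEAUVILLE EXPONENT. The special subvariety of a Prym `P(C̃/C)` (`dim P = 4`) attached to a complete `g^r_e` has class
`2^{e−2r−1}[Ξ]^{4−r}/(4−r)!` [Beauville 1982, Thm 1]; for surfaces (`r = 2`) the class is `θ² = [Ξ]²` iff `e = 6` (`beauville_exponent_six`):
the `g²₆ = |K_C − p − q|`, whose special surfaces are shown in the ladder note (§3) to be the theta complete intersections `Ξ_α ∩ Ξ_{α+ψ(p̃)+ψ(q̃)}`.
All statements below are def-free and fully proved; the module theory / geometry is in the docstrings (DIVERGENCE D5).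
-/

/-- **(T) Trace of a commutator equals zero, in the form used by the TRACE LEMMA.** Over a commutative ring, if two square matrices
satisfy `M N − N M = c • 1 + E` with `tr E = 0` (in the application: `R = k[ε]`, `c = ε·P^{ij}(x)`, `E = ε·`(nilpotent part of the action
of `P^{ij}`), of trace `0`), then `(card n)·c = 0`. [folklore: 'the Weyl algebra has no finite-dimensional representations in
characteristic 0'] -/
theorem trace_commutator_eq {R : Type*} [CommRing R] {n : Type*} [Fintype n] [DecidableEq n]
    (M N E : Matrix n n R) (c : R) (h : M * N - N * M = c • (1 : Matrix n n R) + E) (hE : Matrix.trace E = 0) :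
    (Fintype.card n : R) * c = 0 := by
  have ht : Matrix.trace (M * N - N * M) = Matrix.trace (c • (1 : Matrix n n R) + E) := by rw [h]
  rw [Matrix.trace_sub, Matrix.trace_mul_comm, sub_self, Matrix.trace_add, Matrix.trace_smul, Matrix.trace_one, hE,
    add_zero, smul_eq_mul] at ht
  rw [mul_comm]; exact ht.symm

/-- **(T′) The scalar consequence.** In the TRACE LEMMA the ring is `k[ε]` over a field `k` of characteristic `0` and `c = ε·p` with
`p = P^{ij}(x) ∈ k`; `t·ε·p = 0` with `t ≠ 0` gives `p = 0`. Recorded over `ℚ`-algebras in the form actually needed: a natural number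
`t ≠ 0` times a scalar vanishes only if the scalar does. [folklore] -/
theorem natCast_mul_eq_zero_of_commutator (t : ℕ) (ht : t ≠ 0) (p : ℚ) (h : (t : ℚ) * p = 0) : p = 0 := by
  rcases mul_eq_zero.mp h with h1 | h1
  · exact absurd (by exact_mod_cast h1) ht
  · exact h1

/-- **(C) The corrected two-section count on a theta-intersection with rational double points.** Hypotheses: `hpoly m` is
`2(χ(F(mΘ)) + t) = 2·[2χ(𝓘_S(m))] + 2χ(S, K(m))` with `χ(F(mΘ)) = 2m⁴ − 12m² + 8m`, `χ(𝓘_S(m)) = m⁴ − χ(𝒪_S(m))`,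
`χ(𝒪_S(m)) = 12m² − 24m + 14`, `2χ(S,K(m)) = 28 + N2 + 2Nθ(1 − m) + 24m² − 48m + 2c_K` (Riemann–Roch for the reflexive rank-one
`K ≡ −N` with local correction `c_K`); `hW m` is `χ(K(m)) + χ(N(m)) − ℓ = 2χ(𝒪_S(m))` written out (corrections `c_K + c_N`).
Conclusion: `N·θ_S = 16`, `N² = 2t − 4 − 2c_K`, `ℓ = 2t − 4 − c_K + c_N`. [folklore] -/
theorem twoSection_ci_corrected (N2 Nθ ℓ t cK cN : ℚ)
    (hpoly : ∀ m : ℚ, 2 * (2 * m ^ 4 - 12 * m ^ 2 + 8 * m) + 2 * t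
      = 2 * (2 * (m ^ 4 - (14 + 12 * m ^ 2 - 24 * m))) + (28 + N2 + 2 * Nθ * (1 - m) + 24 * m ^ 2 - 48 * m + 2 * cK))
    (hW : ∀ m : ℚ, (28 + N2 + 24 * m ^ 2 - 48 * m) + cK + cN - ℓ = 2 * (14 + 12 * m ^ 2 - 24 * m)) :
    Nθ = 16 ∧ N2 = 2 * t - 4 - 2 * cK ∧ ℓ = 2 * t - 4 - cK + cN := by
  have h0 := hpoly 0
  have h1 := hpoly 1
  have w0 := hW 0
  norm_num at h0 h1 w0
  refine ⟨by linarith, by linarith, by linarith⟩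

/-- **(C′) Torsion is forced.** With `ℓ = 2t − 4 − c_K + c_N`, `ℓ ≥ 0` (a colength) and `c_N ≤ c_K` (pointwise `δ_w(N) ≤ δ_w(K)`:
at an `A₁` point `δ_w(N) = −1/4` when `N` is non-Cartier, while `K_w`, free or the syzygy of `N_w`, has `δ_w(K) ∈ {0, −1/4}`, and
`δ_w(K) = 0` whenever `N_w` is Cartier), one gets `t ≥ 2`: a would-be `(0,1)` object on ANY nodal theta-intersection carries
0-dimensional torsion, hence (torsion-moduli lemma) an `ι`-fixed point. [folklore] -/
theorem torsion_forced_of_corrections (ℓ t cK cN : ℚ) (hℓ : ℓ = 2 * t - 4 - cK + cN) (hpos : 0 ≤ ℓ) (hc : cN ≤ cK) :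
    2 ≤ t := by
  linarith

/-- **(I) The local index of the non-Cartier `A₁`-module at an `ι`-fixed node.** Graded Betti degrees of `i_*M`,
`M = (x₁,x₃)·k[x₁,x₂,x₃,x₄]/(x₄, x₁x₂ − x₃²)`: generators `[1,1]`, relations `[2,2,2,2]`, second syzygies `[3,3]` (machine: Hilbert
numerator `2z(1 − z)²`); with all coordinates `ι`-odd the index is the alternating sum of `(−1)^{degree}`. [folklore] -/
theorem a1Module_index :
    ((-1 : ℤ) ^ 1 + (-1) ^ 1) - ((-1) ^ 2 + (-1) ^ 2 + (-1) ^ 2 + (-1) ^ 2) + ((-1) ^ 3 + (-1) ^ 3) = -8 := by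
  norm_num

/-- **(I′) The index obstruction at a fixed node.** `t_x(F) = t_x(E) − t_x(T)` with `t_x(E) = 0` (balanced flat hull),
`t_x(T) = t_x(N) + 16u` (`u ∈ ℤ`: finite-length contributions `T₀`, `N/G`), and `t_x(N) = ±8` for non-Cartier `N`: then
`t_x(F) ≠ 0`, contradicting `t ≡ 0`. [folklore] -/
theorem index_obstruction_fixedNode (tE tN u tF : ℤ) (hE : tE = 0) (hN : tN = 8 ∨ tN = -8) (hF : tF = tE - (tN + 16 * u)) :
    tF ≠ 0 := by
  rcases hN with h | h <;> omega

/-- **(I″) Parity at a fixed node.** `t_x(T) = 16(n₊ − n₋) − 16(m₊ − m₋) = 0` (torsion `T₀` with `n_±` composition factors of each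
sign; base cokernel `N/G` with `m_±`) gives `n₊ − n₋ = m₊ − m₋`, hence the torsion length `n₊ + n₋` and the base colength `m₊ + m₋`
at the node have the same parity. [folklore] -/
theorem fixedNode_parity (np nm mp mm : ℤ) (h : np - nm = mp - mm) : (np + nm) % 2 = (mp + mm) % 2 := by
  omega

/-- **(B) The Beauville exponent.** For a surface (`r = 2`, codimension `2` in a Prym fourfold) the class
`2^{e−2r−1}[Ξ]²/2! = 2^{e−5}·[Ξ]²/2` equals `[Ξ]²` iff `2^{e−5} = 2` iff `e = 6` (under Beauville's standing hypothesis `e > 2r`,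
i.e. `e ≥ 5`). [folklore] -/
theorem beauville_exponent_six (e : ℕ) (h5 : 5 ≤ e) (h : 2 ^ (e - 5) = 2) : e = 6 := by
  have h' : 2 ^ (e - 5) = 2 ^ 1 := by simpa using h
  have := Nat.pow_right_injective (le_refl 2) h'
  omega

end H2ZeroOneTrace

end Literature.AlgebraicGeometry.HodgeTheory
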